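import Mathlib
import Summits.Ventures.PercRepro2.BoxUnionDefs

/-!
# The box-union covariance inequality for log-supermodular weights — FKG / Holley steps
(blind cell PercRepro2, mine-1 g36; paper proof proofs/MINE1-BOXUNION.md; part 2 of 3)

All inequalities are instances of Mathlib's Ahlswede–Daykin `four_functions_theorem_univ`:
the Holley inequality between two fibres of `rho` (`S_mul_M_le`, so fibre means are monotone
along `rho` on fibres of positive mass, `fmean_le_fmean`), FKG on a sublattice predicate
(`fkg_on`), the sign of the tension on a down-closed / up-closed set (`down_sign`, `up_sign`),
and the two single-box lemmas `phiOn_nonneg_down`, `phiOn_nonneg_up`: the covariance of two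
support-monotone nonnegative functions restricted to a down-closed (resp. up-closed)
sublattice, centred at the global means, is nonnegative.
-/

namespace Summit.Ventures.PercRepro2

namespace BoxUnion

open Finset

open scoped Classical

noncomputable section

section Sums

variable {α : Type*} [DistribLattice α] [Fintype α]

variable {ν f : α → ℝ} {a b : α}

/-! ### Holley: fibre means are monotone along `ρ` (on fibres of positive mass) -/

/-- The Holley/Ahlswede–Daykin inequality between two fibres `k ≤ k'`:
`S k * M k' ≤ M k * S k'`. -/
lemma S_mul_M_le (hν : ∀ x, 0 ≤ ν x) (hlsm : ∀ x y, ν x * ν y ≤ ν (x ⊓ y) * ν (x ⊔ y))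
    (hf : Monotone f) (hf0 : ∀ x, 0 ≤ f x) {k k' : α × α} (hk : k ≤ k') :
    S ν f a b k * M ν a b k' ≤ M ν a b k * S ν f a b k' := by
  have key := four_functions_theorem_univ
    (fun x => if rho a b x = k then ν x * f x else 0)
    (fun x => if rho a b x = k' then ν x else 0)
    (fun x => if rho a b x = k then ν x else 0)
    (fun x => if rho a b x = k' then ν x * f x else 0)
    (fun x => ite_nonneg (mul_nonneg (hν x) (hf0 x)) le_rfl)
    (fun x => ite_nonneg (hν x) le_rfl)
    (fun x => ite_nonneg (hν x) le_rfl)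
    (fun x => ite_nonneg (mul_nonneg (hν x) (hf0 x)) le_rfl)
    (fun x y => ?_)
  · rw [S_eq, M_eq, M_eq, S_eq]
    exact key
  · by_cases hx : rho a b x = k
    · by_cases hy : rho a b y = k'
      · have h1 : rho a b (x ⊓ y) = k := by rw [rho_inf, hx, hy, inf_eq_left.mpr hk]
        have h2 : rho a b (x ⊔ y) = k' := by rw [rho_sup, hx, hy, sup_eq_right.mpr hk]
        rw [if_pos hx, if_pos hy, if_pos h1, if_pos h2]
        calc ν x * f x * ν y = ν x * ν y * f x := by ring
          _ ≤ ν (x ⊓ y) * ν (x ⊔ y) * f (x ⊔ y) :=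
              mul_le_mul (hlsm x y) (hf le_sup_left) (hf0 x) (mul_nonneg (hν _) (hν _))
          _ = ν (x ⊓ y) * (ν (x ⊔ y) * f (x ⊔ y)) := by ring
      · rw [if_neg hy, mul_zero]
        exact mul_nonneg (ite_nonneg (hν _) le_rfl)
          (ite_nonneg (mul_nonneg (hν _) (hf0 _)) le_rfl)
    · rw [if_neg hx, zero_mul]
      exact mul_nonneg (ite_nonneg (hν _) le_rfl)
        (ite_nonneg (mul_nonneg (hν _) (hf0 _)) le_rfl)

/-- Fibre means are monotone along `ρ` between fibres of positive mass. -/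
lemma fmean_le_fmean (hν : ∀ x, 0 ≤ ν x) (hlsm : ∀ x y, ν x * ν y ≤ ν (x ⊓ y) * ν (x ⊔ y))
    (hf : Monotone f) (hf0 : ∀ x, 0 ≤ f x) {k k' : α × α} (hk : k ≤ k') (hM : 0 < M ν a b k)
    (hM' : 0 < M ν a b k') : fmean ν f a b k ≤ fmean ν f a b k' := by
  unfold fmean
  rw [div_le_div_iff₀ hM hM', mul_comm (S ν f a b k') (M ν a b k)]
  exact S_mul_M_le hν hlsm hf hf0 hk

/-- The fibre-mean function is monotone along `ρ` on points of positive weight. -/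
lemma F_le_F (hν : ∀ x, 0 ≤ ν x) (hlsm : ∀ x y, ν x * ν y ≤ ν (x ⊓ y) * ν (x ⊔ y))
    (hf : Monotone f) (hf0 : ∀ x, 0 ≤ f x)
    {x y : α} (hxy : rho a b x ≤ rho a b y) (hx : 0 < ν x) (hy : 0 < ν y) :
    F ν f a b x ≤ F ν f a b y :=
  fmean_le_fmean hν hlsm hf hf0 hxy (lt_of_lt_of_le hx (nu_le_M hν x))
    (lt_of_lt_of_le hy (nu_le_M hν y))

/-- The fibre-mean function is "support-monotone": `F x ≤ F (x ⊔ y)` whenever `ν x, ν y > 0`. -/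
lemma F_le_F_sup (hν : ∀ x, 0 ≤ ν x) (hlsm : ∀ x y, ν x * ν y ≤ ν (x ⊓ y) * ν (x ⊔ y))
    (hf : Monotone f)
    (hf0 : ∀ x, 0 ≤ f x) (x y : α) (hx : 0 < ν x) (hy : 0 < ν y) :
    F ν f a b x ≤ F ν f a b (x ⊔ y) :=
  F_le_F hν hlsm hf hf0 (rho_mono a b le_sup_left) hx (nu_sup_pos hν hlsm hx hy)

/-! ### FKG-type inequalities for support-monotone nonnegative functions -/

section General

variable {φ ψ : α → ℝ}

/-- **FKG on a sublattice** `P` (closed under `⊓` and `⊔`), for support-monotone nonnegative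
`φ ψ`: `(∑_P ν φ)(∑_P ν ψ) ≤ (∑_P ν)(∑_P ν φ ψ)`. -/
lemma fkg_on (hν : ∀ x, 0 ≤ ν x) (hlsm : ∀ x y, ν x * ν y ≤ ν (x ⊓ y) * ν (x ⊔ y))
    (hφ0 : ∀ x, 0 ≤ φ x)
    (hψ0 : ∀ x, 0 ≤ ψ x) (hφ : ∀ x y, 0 < ν x → 0 < ν y → φ x ≤ φ (x ⊔ y))
    (hψ : ∀ x y, 0 < ν x → 0 < ν y → ψ x ≤ ψ (x ⊔ y)) (P : α → Prop) [DecidablePred P]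
    (hP : ∀ x y, P x → P y → P (x ⊓ y) ∧ P (x ⊔ y)) :
    (∑ x, if P x then ν x * φ x else 0) * (∑ x, if P x then ν x * ψ x else 0)
      ≤ (∑ x, if P x then ν x else 0) * (∑ x, if P x then ν x * (φ x * ψ x) else 0) := by
  refine four_functions_theorem_univ _ _ _ _
    (fun x => ite_nonneg (mul_nonneg (hν x) (hφ0 x)) le_rfl)
    (fun x => ite_nonneg (mul_nonneg (hν x) (hψ0 x)) le_rfl)
    (fun x => ite_nonneg (hν x) le_rfl)
    (fun x => ite_nonneg (mul_nonneg (hν x) (mul_nonneg (hφ0 x) (hψ0 x))) le_rfl)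
    (fun x y => ?_)
  by_cases hx : P x
  · by_cases hy : P y
    · rw [if_pos hx, if_pos hy, if_pos (hP x y hx hy).1, if_pos (hP x y hx hy).2]
      exact key_two hν hlsm hφ0 hψ0 hφ hψ x y
    · rw [if_neg hy, mul_zero]
      exact mul_nonneg (ite_nonneg (hν _) le_rfl)
        (ite_nonneg (mul_nonneg (hν _) (mul_nonneg (hφ0 _) (hψ0 _))) le_rfl)
  · rw [if_neg hx, zero_mul]
    exact mul_nonneg (ite_nonneg (hν _) le_rfl)
      (ite_nonneg (mul_nonneg (hν _) (mul_nonneg (hφ0 _) (hψ0 _))) le_rfl)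

/-- **Sign of the tension on a down-closed set** `P` (`P x → P (x ⊓ y)`):
`(∑_P ν φ)(∑ ν) ≤ (∑_P ν)(∑ ν φ)`, i.e. the `P`-mean of `φ` is at most its mean. -/
lemma down_sign (hν : ∀ x, 0 ≤ ν x) (hlsm : ∀ x y, ν x * ν y ≤ ν (x ⊓ y) * ν (x ⊔ y))
    (hφ0 : ∀ x, 0 ≤ φ x)
    (hφ : ∀ x y, 0 < ν x → 0 < ν y → φ x ≤ φ (x ⊔ y)) (P : α → Prop) [DecidablePred P]
    (hP : ∀ x y, P x → P (x ⊓ y)) :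
    (∑ x, if P x then ν x * φ x else 0) * (∑ x, ν x)
      ≤ (∑ x, if P x then ν x else 0) * (∑ x, ν x * φ x) := by
  refine four_functions_theorem_univ _ _ _ _
    (fun x => ite_nonneg (mul_nonneg (hν x) (hφ0 x)) le_rfl)
    (fun x => hν x)
    (fun x => ite_nonneg (hν x) le_rfl)
    (fun x => mul_nonneg (hν x) (hφ0 x))
    (fun x y => ?_)
  by_cases hx : P x
  · rw [if_pos hx, if_pos (hP x y hx)]
    exact key_left hν hlsm hφ0 hφ x y
  · rw [if_neg hx, zero_mul]
    exact mul_nonneg (ite_nonneg (hν _) le_rfl) (mul_nonneg (hν _) (hφ0 _))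

/-- **Sign of the tension on an up-closed set** `P` (`P x → P (x ⊔ y)`):
`(∑_P ν)(∑ ν ψ) ≤ (∑ ν)(∑_P ν ψ)`, i.e. the `P`-mean of `ψ` is at least its mean. -/
lemma up_sign (hν : ∀ x, 0 ≤ ν x) (hlsm : ∀ x y, ν x * ν y ≤ ν (x ⊓ y) * ν (x ⊔ y))
    (hψ0 : ∀ x, 0 ≤ ψ x)
    (hψ : ∀ x y, 0 < ν x → 0 < ν y → ψ x ≤ ψ (x ⊔ y)) (P : α → Prop) [DecidablePred P]
    (hP : ∀ x y, P x → P (x ⊔ y)) :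
    (∑ x, if P x then ν x else 0) * (∑ x, ν x * ψ x)
      ≤ (∑ x, ν x) * (∑ x, if P x then ν x * ψ x else 0) := by
  refine four_functions_theorem_univ _ _ _ _
    (fun x => ite_nonneg (hν x) le_rfl)
    (fun x => mul_nonneg (hν x) (hψ0 x))
    (fun x => hν x)
    (fun x => ite_nonneg (mul_nonneg (hν x) (hψ0 x)) le_rfl)
    (fun x y => ?_)
  by_cases hx : P x
  · rw [if_pos hx, if_pos (hP x y hx)]
    exact key_right hν hlsm hψ0 hψ x y
  · rw [if_neg hx, zero_mul]
    exact mul_nonneg (hν _) (ite_nonneg (mul_nonneg (hν _) (hψ0 _)) le_rfl)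

omit [DistribLattice α] in
/-- Expanding the restricted covariance. -/
lemma phiOn_expand (P : α → Prop) [DecidablePred P] (m m' : ℝ) :
    phiOn ν φ ψ m m' P
      = (∑ x, if P x then ν x * (φ x * ψ x) else 0)
        - m * (∑ x, if P x then ν x * ψ x else 0)
        - m' * (∑ x, if P x then ν x * φ x else 0)
        + m * m' * (∑ x, if P x then ν x else 0) := by
  simp only [phiOn, mul_sum, ← sum_sub_distrib, ← sum_add_distrib]
  refine sum_congr rfl fun x _ => ?_
  split_ifs <;> ring

omit [DistribLattice α] in
/-- Nonnegative sums restricted to a set of zero mass vanish. -/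
lemma sum_ite_eq_zero_of_mass (hν : ∀ x, 0 ≤ ν x) (P : α → Prop) [DecidablePred P]
    (hN : (∑ x, if P x then ν x else 0) = 0) (c : α → ℝ) :
    (∑ x, if P x then ν x * c x else 0) = 0 := by
  have hz : ∀ x, P x → ν x = 0 := by
    intro x hx
    have := (sum_eq_zero_iff_of_nonneg (fun y _ => ite_nonneg (hν y) le_rfl)).mp hN x (mem_univ x)
    rwa [if_pos hx] at this
  exact sum_eq_zero fun x _ => by
    split_ifs with h
    · rw [hz x h, zero_mul]
    · rfl

/-- **Single down-box lemma.** On a down-closed sublattice `P`, the restricted covariance of two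
support-monotone nonnegative functions (centred at their global means) is nonnegative. -/
lemma phiOn_nonneg_down (hν : ∀ x, 0 ≤ ν x) (hlsm : ∀ x y, ν x * ν y ≤ ν (x ⊓ y) * ν (x ⊔ y))
    (hZ : 0 < ∑ x, ν x)
    (hφ0 : ∀ x, 0 ≤ φ x) (hψ0 : ∀ x, 0 ≤ ψ x)
    (hφ : ∀ x y, 0 < ν x → 0 < ν y → φ x ≤ φ (x ⊔ y))
    (hψ : ∀ x y, 0 < ν x → 0 < ν y → ψ x ≤ ψ (x ⊔ y)) (P : α → Prop) [DecidablePred P]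
    (hPsub : ∀ x y, P x → P y → P (x ⊓ y) ∧ P (x ⊔ y)) (hPdown : ∀ x y, P x → P (x ⊓ y)) :
    0 ≤ phiOn ν φ ψ (mean ν φ) (mean ν ψ) P := by
  rw [phiOn_expand]
  have hfkg := fkg_on hν hlsm hφ0 hψ0 hφ hψ P hPsub
  have hY := down_sign hν hlsm hφ0 hφ P hPdown
  have hW := down_sign hν hlsm hψ0 hψ P hPdown
  set N := ∑ x, if P x then ν x else 0 with hNdef
  set X := ∑ x, if P x then ν x * (φ x * ψ x) else 0 with hXdef
  set Y := ∑ x, if P x then ν x * φ x else 0 with hYdef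
  set W := ∑ x, if P x then ν x * ψ x else 0 with hWdef
  set Z := ∑ x, ν x with hZdef
  set T := ∑ x, ν x * φ x with hTdef
  set T' := ∑ x, ν x * ψ x with hT'def
  have hmean : mean ν φ = T / Z := rfl
  have hmean' : mean ν ψ = T' / Z := rfl
  rw [hmean, hmean']
  set m := T / Z with hm
  set m' := T' / Z with hm'
  have hN0 : 0 ≤ N := sum_nonneg fun x _ => ite_nonneg (hν x) le_rfl
  rcases hN0.lt_or_eq with hN | hN
  · have hY' : Y ≤ N * m := by
      rw [hm, mul_div_assoc', le_div_iff₀ hZ]; exact hY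
    have hW' : W ≤ N * m' := by
      rw [hm', mul_div_assoc', le_div_iff₀ hZ]; exact hW
    have h2 : 0 ≤ (Y - N * m) * (W - N * m') := by nlinarith
    nlinarith
  · have hX : X = 0 := sum_ite_eq_zero_of_mass hν P hN.symm _
    have hY0 : Y = 0 := sum_ite_eq_zero_of_mass hν P hN.symm _
    have hW0 : W = 0 := sum_ite_eq_zero_of_mass hν P hN.symm _
    rw [hX, hY0, hW0, ← hN]
    ring_nf
    exact le_rfl

/-- **Single up-box lemma.** On an up-closed sublattice `P`, the restricted covariance of two
support-monotone nonnegative functions (centred at their global means) is nonnegative. -/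
lemma phiOn_nonneg_up (hν : ∀ x, 0 ≤ ν x) (hlsm : ∀ x y, ν x * ν y ≤ ν (x ⊓ y) * ν (x ⊔ y))
    (hZ : 0 < ∑ x, ν x)
    (hφ0 : ∀ x, 0 ≤ φ x) (hψ0 : ∀ x, 0 ≤ ψ x)
    (hφ : ∀ x y, 0 < ν x → 0 < ν y → φ x ≤ φ (x ⊔ y))
    (hψ : ∀ x y, 0 < ν x → 0 < ν y → ψ x ≤ ψ (x ⊔ y)) (P : α → Prop) [DecidablePred P]
    (hPsub : ∀ x y, P x → P y → P (x ⊓ y) ∧ P (x ⊔ y)) (hPup : ∀ x y, P x → P (x ⊔ y)) :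
    0 ≤ phiOn ν φ ψ (mean ν φ) (mean ν ψ) P := by
  rw [phiOn_expand]
  have hfkg := fkg_on hν hlsm hφ0 hψ0 hφ hψ P hPsub
  have hY := up_sign hν hlsm hφ0 hφ P hPup
  have hW := up_sign hν hlsm hψ0 hψ P hPup
  set N := ∑ x, if P x then ν x else 0 with hNdef
  set X := ∑ x, if P x then ν x * (φ x * ψ x) else 0 with hXdef
  set Y := ∑ x, if P x then ν x * φ x else 0 with hYdef
  set W := ∑ x, if P x then ν x * ψ x else 0 with hWdef
  set Z := ∑ x, ν x with hZdef
  set T := ∑ x, ν x * φ x with hTdef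
  set T' := ∑ x, ν x * ψ x with hT'def
  have hmean : mean ν φ = T / Z := rfl
  have hmean' : mean ν ψ = T' / Z := rfl
  rw [hmean, hmean']
  set m := T / Z with hm
  set m' := T' / Z with hm'
  have hN0 : 0 ≤ N := sum_nonneg fun x _ => ite_nonneg (hν x) le_rfl
  rcases hN0.lt_or_eq with hN | hN
  · have hY' : N * m ≤ Y := by
      rw [hm, mul_div_assoc', div_le_iff₀ hZ]; linarith [hY]
    have hW' : N * m' ≤ W := by
      rw [hm', mul_div_assoc', div_le_iff₀ hZ]; linarith [hW]
    have h2 : 0 ≤ (Y - N * m) * (W - N * m') := by nlinarith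
    nlinarith
  · have hX : X = 0 := sum_ite_eq_zero_of_mass hν P hN.symm _
    have hY0 : Y = 0 := sum_ite_eq_zero_of_mass hν P hN.symm _
    have hW0 : W = 0 := sum_ite_eq_zero_of_mass hν P hN.symm _
    rw [hX, hY0, hW0, ← hN]
    ring_nf
    exact le_rfl


end General

end Sums

end

end BoxUnion

end Summit.Ventures.PercRepro2
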